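import Literature.Barriers.PneNP.RigidityCombinatorialBarrier
import Literature.Barriers.PneNP.HadamardNotRigid
import Mathlib.Algebra.MvPolynomial.Funext
import Mathlib.Analysis.SpecialFunctions.Pow.Asymptotics
import HarnessLib

/-!
# Barrier catalogue `PneNP`: the combinatorial rigidity barrier — proofs
(limitation (ii) in sharp form: total nonsingularity is capped at the step-(2) quantity;
Thm. 2.12 in its one-family form, and hence the barrier itself, proved)

Sibling proof file of `Literature/Barriers/PneNP/RigidityCombinatorialBarrier.lean` (theorems
only, plus three auxiliary definitions of the witness family). That file records Lokam's two
printed limitations of the two-step strategy for rigidity lower bounds — (i) the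
untouched-submatrix step certifies at most `O((n²/r) log(n/r))` changes (PROVED there as
`untouched_submatrix_cover`, constant `6`, natural log, `1 ≤ r ≤ n/2`), and (ii) total
nonsingularity alone gives at most `R_A(εn) = n^{1+o(1)}` (Valiant; Lokam 2009, Thm. 2.12,
PDF p. 25; the named fact `Lokam2009_thm_2_12`). This file proves that (ii) holds in a much
sharper form, with the SAME quantity as (i), and then (ii) itself in its printed
one-family-for-all-`ε` form, so that the barrier `RigidityCombinatorialBarrier` is a theorem:

* `exists_totallyNonsingular_rigidity_le_card`: for ANY set `T` of positions meeting every
  `(r+1) × (r+1)` submatrix of the `n × n` array there is a totally nonsingular integer matrix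
  `A` (total nonsingularity and rigidity over `ℚ`) with `R^ℚ_A(r) ≤ |T|`;
* `totalNonsingularity_cap`: hence, with the hitting set of (i), for all `1 ≤ r ≤ n/2` a totally
  nonsingular integer matrix with `R^ℚ_A(r) ≤ 6 (n²/r) ln(n/r)` — `O((n/ε) log(1/ε)) = O(n)` at
  `r = εn` (`exists_totallyNonsingular_rigidity_linear`), and the pointwise reading
  `∀ ε η > 0, ∀ᶠ n, ∃ A` totally nonsingular with `R(⌈εn⌉) ≤ n^{1+η}` of Thm. 2.12 WITHOUT the
  named fact (`forall_eventually_exists_totallyNonsingular`; cf.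
  `Lokam2009_thm_2_12.forall_eventually_exists`, which assumed it);
* `IsTotallyNonsingular.le_rigidity`: the converse untouched-submatrix bound (the proof of
  Lokam's Thm. 2.5, PDF p. 20, in abstract form: if fewer than `R₀` changes always leave an
  `(r+1) × (r+1)` submatrix untouched then `R_A(r) ≥ R₀` for totally nonsingular `A`), so that
* `exists_hitting_iff_exists_totallyNonsingular`: a hitting set of size `≤ m` exists iff a
  totally nonsingular integer matrix with `R^ℚ(r) ≤ m` exists — the untouched-submatrix bound
  is EXACTLY the least rigidity over totally nonsingular matrices, for every `n, r, m`;
* `exists_family_totallyNonsingular_rigidity_le`: ONE family `A_n` of totally nonsingular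
  integer matrices with `R^ℚ_{A_n}(⌊n/⌊log₂ n⌋⌋) ≤ 24 n ln² n` for all `n ≥ 4` (the witness of
  `totalNonsingularity_cap` at the vanishing rank `r = ⌊n/⌊log₂ n⌋⌋`, `div_log_rank_bound`);
* `Lokam2009_thm_2_12_holds`: the named fact (ii) — ONE totally nonsingular family with
  `R^ℚ_{A_n}(⌈εn⌉) ≤ n^{1+η}` eventually, for every `ε, η > 0` (Lokam 2009, Thm. 2.12, PDF
  p. 25, upper-bound half as vendored) — PROVED from the previous bullet by antitonicity of
  rigidity in the target rank (`rigidity_anti`): `⌊n/⌊log₂ n⌋⌋ ≤ ⌈εn⌉` and `24 ln² n ≤ n^η`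
  eventually; hence `RigidityCombinatorialBarrier_holds` (the barrier
  `UntouchedSubmatrixCap ∧ Lokam2009_thm_2_12` of the main file) and the unconditional reading
  `exists_family_totallyNonsingular_not_rigid`.

Consequently the two printed limitations are one barrier: an argument whose only input about
the explicit matrix is a property implied by total nonsingularity (any profile of ranks of
submatrices, touched or untouched, one or many) proves its bound for the witness `A_T` as
well, so it certifies at most the least hitting set, `≤ 6 (n²/r) ln(n/r)`.

## Proof

The witness is `A = U Vᵀ + C_T` (`pertMatrix`) with `U, V` integer `n × r` matrices and `C_T`
supported inside `T`, at a suitable integer point of the `2nr + n²` variables (`PertVars`).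
`R^ℚ_A(r) ≤ |T|` because `A - C_T = U Vᵀ` has rank `≤ r` (`rigidity_pertMatrix_le`). Every
minor is generically nonzero (`exists_point_minor_ne_zero`, by induction on the size `k` of
the minor): for `k ≤ r` put `C_T = 0` and let `U, V` route the `k` chosen rows and columns
through `k` distinct coordinates, so the minor is `det 1 = 1`; for `k > r` the `k` rows and
`k` columns contain `(r+1)`-subsets, hence an entry `p ∈ T` inside the minor; by induction
some point makes the complementary `(k-1) × (k-1)` minor nonzero, and as a function of the
sparse variable at `p` the minor is affine with that cofactor as slope
(`det_eq_of_eq_off_entry`, Laplace expansion along the row of `p`), so the value `0` or `1` of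
that variable makes it nonzero. The minors are the evaluations of finitely many polynomials
(`genPertMatrix`, `eval_det_genPertMatrix_submatrix`), each nonzero, so their product is a
nonzero polynomial over the infinite domain `ℤ` and has a non-root (`MvPolynomial.funext`):
one integer point makes all minors nonzero (`exists_point_forall_minor_ne_zero`). The converse
bound: an untouched `(r+1) × (r+1)` submatrix of `A + C` equals that submatrix of `A`, which
is nonsingular, so `rank (A + C) ≥ r + 1` (`Matrix.rank_submatrix_le`, `Matrix.rank_of_isUnit`).

For Thm. 2.12 (one family serving every `ε` at once) the printed proof (PDF pp. 25–26) builds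
`A` from a linear-size logarithmic-depth superconcentrator and applies the decomposition of
Thm. 2.1; neither is in the tree. Instead take, for each `n ≥ 4`, the witness of
`totalNonsingularity_cap` at the rank `r(n) = ⌊n/L⌋`, `L = ⌊log₂ n⌋ ≥ 2` (so `1 ≤ r(n)`,
`2 r(n) ≤ n`): since `n < L (r(n) + 1) ≤ 2 L r(n)`, `L ≤ ln n / ln 2 ≤ 2 ln n` and
`ln(n/r(n)) ≤ ln n`, its rigidity at rank `r(n)` is `≤ 6 (n²/r(n)) ln(n/r(n)) ≤ 24 n ln² n`.
For fixed `ε > 0`, once `L ≥ ⌈1/ε⌉` (i.e. `n ≥ 2^{⌈1/ε⌉}`) one has `r(n) ≤ n/L ≤ εn ≤ ⌈εn⌉`, so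
`R(⌈εn⌉) ≤ R(r(n))` (`rigidity_anti`); and `ln n ≤ n^{η/2}/5` eventually
(`isLittleO_log_rpow_atTop`) gives `24 n ln² n ≤ (24/25) n^{1+η}`.

## Sources

* [Lokam2009] S. V. Lokam, *Complexity lower bounds using linear algebra*, Found. Trends TCS 4
  (2009), PDF pp. 19–20 (Lemma 2.4, Thm. 2.5), 24–25 (§2.2.1, Thm. 2.12) — held
  (`lit read paper:doi-10-1561-0400000011`).
* The sharp form and the witness family are this tree's (barrier audit 2026-08-14); we did not
  find them in print (Lokam, PDF p. 24, and Jukna 2012, Thm. 13.41, state only the hitting set and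
  Valiant's `n^{1+o(1)}`; Shokrollahi–Spielman–Stemann 1997 is not held, acq-00838) — tagged
  `[folklore]` as elementary.

What is NOT here: superconcentrators and Valiant's decomposition (Thm. 2.1), i.e. the printed
route to Thm. 2.12 (which is proved by the vanishing-rank route above instead), and the lower
half of the printed "`R_A(r) = n^{1+o(1)}`" (not vendored); finite fields (the generic-point
step uses that `ℤ` is infinite); any statement about the rigidity of a particular explicit
matrix.
-/

noncomputable section

open Finset Filter Matrix

namespace Literature.Barriers.PneNP


/-- Variables of the generic "rank-`r` plus `T`-sparse" `n × n` matrix `U Vᵀ + C_T`: the entries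
of `U`, of `V` (both `n × r`) and of the sparse part `C_T`. [folklore] -/
abbrev PertVars (n r : ℕ) : Type := (Fin n × Fin r) ⊕ (Fin n × Fin r) ⊕ (Fin n × Fin n)

/-- The integer matrix `U Vᵀ + C_T` at the integer point `x`: entry `(i, j)` is
`∑ₗ U i l · V j l`, plus `C i j` when `(i, j) ∈ T` (so the sparse part is supported inside `T`).
[folklore] -/
def pertMatrix {n r : ℕ} (T : Finset (Fin n × Fin n)) (x : PertVars n r → ℤ) :
    Matrix (Fin n) (Fin n) ℤ :=
  Matrix.of fun i j => (∑ l : Fin r, x (Sum.inl (i, l)) * x (Sum.inr (Sum.inl (j, l)))) +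
    (if (i, j) ∈ T then x (Sum.inr (Sum.inr (i, j))) else 0)

/-- The same matrix with indeterminate entries, over `MvPolynomial (PertVars n r) ℤ` (its minors
are the "minor polynomials" evaluated in `eval_det_genPertMatrix_submatrix`). [folklore] -/
def genPertMatrix {n r : ℕ} (T : Finset (Fin n × Fin n)) :
    Matrix (Fin n) (Fin n) (MvPolynomial (PertVars n r) ℤ) :=
  Matrix.of fun i j =>
    (∑ l : Fin r, MvPolynomial.X (Sum.inl (i, l)) * MvPolynomial.X (Sum.inr (Sum.inl (j, l)))) +
    (if (i, j) ∈ T then MvPolynomial.X (Sum.inr (Sum.inr (i, j))) else 0)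

/-- Entry formula for `pertMatrix`. [folklore] -/
theorem pertMatrix_apply {n r : ℕ} (T : Finset (Fin n × Fin n)) (x : PertVars n r → ℤ)
    (i j : Fin n) : pertMatrix T x i j =
      (∑ l : Fin r, x (Sum.inl (i, l)) * x (Sum.inr (Sum.inl (j, l)))) +
        (if (i, j) ∈ T then x (Sum.inr (Sum.inr (i, j))) else 0) := rfl

/-- Evaluating the generic matrix at an integer point gives `pertMatrix`. [folklore] -/
theorem genPertMatrix_map_eval {n r : ℕ} (T : Finset (Fin n × Fin n)) (x : PertVars n r → ℤ) :
    (genPertMatrix T).map (MvPolynomial.eval x) = pertMatrix T x := by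
  ext i j
  simp [genPertMatrix, pertMatrix, map_sum, apply_ite (MvPolynomial.eval x)]

/-- Evaluating a minor polynomial of the generic matrix gives the corresponding minor of
`pertMatrix` (`RingHom.map_det`). [folklore] -/
theorem eval_det_genPertMatrix_submatrix {n r : ℕ} (T : Finset (Fin n × Fin n))
    (x : PertVars n r → ℤ) {k : ℕ} (ρ κ : Fin k → Fin n) :
    MvPolynomial.eval x ((genPertMatrix T).submatrix ρ κ).det =
      ((pertMatrix T x).submatrix ρ κ).det := by
  rw [RingHom.map_det, RingHom.mapMatrix_apply, ← genPertMatrix_map_eval T x]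
  rfl

open Classical in
/-- A matrix supported inside `T` has at most `|T|` nonzero entries. [folklore] -/
theorem nnzEntries_le_card {n : ℕ} {F : Type*} [Zero F] (C : Matrix (Fin n) (Fin n) F)
    (T : Finset (Fin n × Fin n)) (h : ∀ p ∉ T, C p.1 p.2 = 0) : nnzEntries C ≤ T.card := by
  unfold nnzEntries
  apply Finset.card_le_card
  intro p hp
  rw [Finset.mem_filter] at hp
  by_contra hpT
  exact hp.2 (h p hpT)

/-- `R^ℚ_{U Vᵀ + C_T}(r) ≤ |T|`: subtracting `C_T` (at most `|T|` nonzero entries) leaves `U Vᵀ`,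
of rank `≤ r` (`U` is `n × r`). [folklore] -/
theorem rigidity_pertMatrix_le {n r : ℕ} (T : Finset (Fin n × Fin n)) (x : PertVars n r → ℤ) :
    rigidity ((pertMatrix T x).map (Int.cast : ℤ → ℚ)) r ≤ T.card := by
  classical
  set U : Matrix (Fin n) (Fin r) ℚ := Matrix.of fun i l => (x (Sum.inl (i, l)) : ℚ) with hU
  set V : Matrix (Fin n) (Fin r) ℚ := Matrix.of fun j l => (x (Sum.inr (Sum.inl (j, l))) : ℚ)
    with hV
  set C : Matrix (Fin n) (Fin n) ℚ :=
    Matrix.of fun i j => if (i, j) ∈ T then (x (Sum.inr (Sum.inr (i, j))) : ℚ) else 0 with hC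
  have hA : (pertMatrix T x).map (Int.cast : ℤ → ℚ) + (-C) = U * Vᵀ := by
    ext i j
    simp only [map_apply, pertMatrix_apply, Matrix.add_apply, Matrix.neg_apply, mul_apply,
      transpose_apply, of_apply, hU, hV, hC]
    push_cast
    split_ifs <;> simp
  have hrank : ((pertMatrix T x).map (Int.cast : ℤ → ℚ) + (-C)).rank ≤ r := by
    rw [hA]
    exact (Matrix.rank_mul_le_left _ _).trans (Matrix.rank_le_width U)
  have hmem : nnzEntries (-C) ∈ {s | ∃ C' : Matrix (Fin n) (Fin n) ℚ,
      ((pertMatrix T x).map (Int.cast : ℤ → ℚ) + C').rank ≤ r ∧ nnzEntries C' = s} :=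
    ⟨-C, hrank, rfl⟩
  refine (Nat.sInf_le hmem).trans (nnzEntries_le_card _ T fun p hp => ?_)
  have : (p.1, p.2) ∉ T := hp
  simp [hC, this]

/-- Rank-one update of a determinant along one entry: if `M'` agrees with `M` except possibly
at `(a, b)`, then `det M' = det M + (-1)^(a+b) (M' a b - M a b) det M^{(a,b)}`. [folklore] -/
theorem det_eq_of_eq_off_entry {R : Type*} [CommRing R] {k : ℕ}
    (M M' : Matrix (Fin (k + 1)) (Fin (k + 1)) R) (a b : Fin (k + 1))
    (hrow : ∀ i j, i ≠ a → M' i j = M i j) (hcol : ∀ j, j ≠ b → M' a j = M a j) :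
    M'.det = M.det + (-1) ^ (a + b : ℕ) * (M' a b - M a b) *
      (M.submatrix a.succAbove b.succAbove).det := by
  have hsub : ∀ j : Fin (k + 1),
      M'.submatrix a.succAbove j.succAbove = M.submatrix a.succAbove j.succAbove := by
    intro j
    ext i l
    exact hrow _ _ (Fin.succAbove_ne a i)
  obtain ⟨δ, hδ⟩ : ∃ δ, M' a b - M a b = δ := ⟨_, rfl⟩
  have hentry : ∀ j : Fin (k + 1), M' a j = M a j + (if j = b then δ else 0) := by
    intro j
    by_cases hj : j = b
    · subst hj
      rw [if_pos rfl, ← hδ]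
      ring
    · rw [if_neg hj, hcol j hj, add_zero]
  rw [Matrix.det_succ_row M' a, Matrix.det_succ_row M a, hδ]
  simp_rw [hsub, hentry, mul_add, add_mul, Finset.sum_add_distrib]
  congr 1
  rw [Finset.sum_eq_single b]
  · simp
  · intro j _ hj
    simp [hj]
  · simp

/-- Changing the sparse variable at position `p` does not change the other entries. [folklore] -/
theorem pertMatrix_update_apply {n r : ℕ} (T : Finset (Fin n × Fin n)) (x : PertVars n r → ℤ)
    (p : Fin n × Fin n) (t : ℤ) (i j : Fin n) (h : (i, j) ≠ p) :
    pertMatrix T (Function.update x (Sum.inr (Sum.inr p)) t) i j = pertMatrix T x i j := by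
  simp [pertMatrix_apply, h]

/-- Changing the sparse variable at a position `p ∈ T` to `t` sets entry `p` to `(U Vᵀ) p + t`.
[folklore] -/
theorem pertMatrix_update_apply_self {n r : ℕ} (T : Finset (Fin n × Fin n))
    (x : PertVars n r → ℤ) (p : Fin n × Fin n) (t : ℤ) (hp : p ∈ T) :
    pertMatrix T (Function.update x (Sum.inr (Sum.inr p)) t) p.1 p.2 =
      (∑ l : Fin r, x (Sum.inl (p.1, l)) * x (Sum.inr (Sum.inl (p.2, l)))) + t := by
  simp [pertMatrix_apply, hp]

/-- **Generic nonvanishing of every minor.** If `T` meets every `(r+1) × (r+1)` submatrix then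
each fixed minor of `U Vᵀ + C_T` is nonzero at some integer point (by induction on the size
`k`: identity pattern through `U Vᵀ` for `k ≤ r`, Laplace expansion along an entry of `T`
inside the minor for `k > r`). [folklore] -/
theorem exists_point_minor_ne_zero {n r : ℕ} (T : Finset (Fin n × Fin n))
    (hT : ∀ R C : Finset (Fin n), R.card = r + 1 → C.card = r + 1 → ∃ p ∈ T, p.1 ∈ R ∧ p.2 ∈ C)
    (k : ℕ) (ρ κ : Fin k ↪ Fin n) :
    ∃ x : PertVars n r → ℤ, ((pertMatrix T x).submatrix ρ κ).det ≠ 0 := by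
  classical
  induction k with
  | zero => exact ⟨0, by simp⟩
  | succ k ih =>
    rcases Nat.lt_or_ge k r with hk | hk
    · -- `k + 1 ≤ r`: realise the identity through `U Vᵀ`, with `C_T = 0`.
      have hm : k + 1 ≤ r := hk
      refine ⟨Sum.elim (fun il => if ∃ a : Fin (k + 1), ρ a = il.1 ∧ Fin.castLE hm a = il.2
          then 1 else 0) (Sum.elim (fun jl => if ∃ b : Fin (k + 1), κ b = jl.1 ∧
          Fin.castLE hm b = jl.2 then 1 else 0) (fun _ => 0)), ?_⟩
      have hsub : (pertMatrix T (Sum.elim (fun il => if ∃ a : Fin (k + 1), ρ a = il.1 ∧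
          Fin.castLE hm a = il.2 then 1 else 0) (Sum.elim (fun jl => if ∃ b : Fin (k + 1),
          κ b = jl.1 ∧ Fin.castLE hm b = jl.2 then 1 else 0) (fun _ => (0 : ℤ))))).submatrix ρ κ =
          1 := by
        ext a b
        simp only [submatrix_apply, pertMatrix_apply, Sum.elim_inl, Sum.elim_inr,
          EmbeddingLike.apply_eq_iff_eq, exists_eq_left, ite_mul, one_mul, zero_mul,
          Finset.sum_ite_eq, Finset.mem_univ, if_true, Fin.castLE_inj, ite_self, add_zero,
          Matrix.one_apply]
        simp [eq_comm]
      rw [hsub, det_one]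
      exact one_ne_zero
    · -- `k ≥ r`: Laplace expansion along an entry of `T` inside the minor.
      obtain ⟨R, hRsub, hRcard⟩ := Finset.exists_subset_card_eq
        (s := (Finset.univ : Finset (Fin (k + 1))).map ρ) (n := r + 1) (by simp; omega)
      obtain ⟨C, hCsub, hCcard⟩ := Finset.exists_subset_card_eq
        (s := (Finset.univ : Finset (Fin (k + 1))).map κ) (n := r + 1) (by simp; omega)
      obtain ⟨p, hpT, hp1, hp2⟩ := hT R C hRcard hCcard
      obtain ⟨a, -, ha⟩ := Finset.mem_map.1 (hRsub hp1)
      obtain ⟨b, -, hb⟩ := Finset.mem_map.1 (hCsub hp2)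
      have hpab : p = (ρ a, κ b) := by ext <;> simp [ha, hb]
      set ρ' : Fin k ↪ Fin n := (Fin.succAboveEmb a).trans ρ with hρ'
      set κ' : Fin k ↪ Fin n := (Fin.succAboveEmb b).trans κ with hκ'
      obtain ⟨x', hx'⟩ := ih ρ' κ'
      let xt : ℤ → PertVars n r → ℤ := fun t => Function.update x' (Sum.inr (Sum.inr p)) t
      have key : ∀ t, ((pertMatrix T (xt t)).submatrix ρ κ).det =
          ((pertMatrix T (xt 0)).submatrix ρ κ).det +
            (-1) ^ (a + b : ℕ) * t * ((pertMatrix T x').submatrix ρ' κ').det := by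
        intro t
        have hM : ((pertMatrix T (xt 0)).submatrix ρ κ).submatrix a.succAbove b.succAbove =
            (pertMatrix T x').submatrix ρ' κ' := by
          ext i j
          simp only [submatrix_apply, hρ', hκ', Function.Embedding.trans_apply,
            Fin.succAboveEmb_apply]
          apply pertMatrix_update_apply
          rw [hpab]
          simp [Fin.succAbove_ne]
        rw [det_eq_of_eq_off_entry ((pertMatrix T (xt 0)).submatrix ρ κ)
          ((pertMatrix T (xt t)).submatrix ρ κ) a b, hM]
        · congr 2
          simp only [submatrix_apply]
          rw [show ρ a = p.1 from ha, show κ b = p.2 from hb,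
            pertMatrix_update_apply_self T x' p t hpT, pertMatrix_update_apply_self T x' p 0 hpT]
          ring
        · intro i j hi
          simp only [submatrix_apply]
          rw [pertMatrix_update_apply, pertMatrix_update_apply]
          all_goals
            rw [hpab]
            simp [hi]
        · intro j hj
          simp only [submatrix_apply]
          rw [pertMatrix_update_apply, pertMatrix_update_apply]
          all_goals
            rw [hpab]
            simp [hj]
      by_cases h0 : ((pertMatrix T (xt 0)).submatrix ρ κ).det = 0
      · refine ⟨xt 1, ?_⟩
        rw [key 1, h0, zero_add, mul_one]
        exact mul_ne_zero (pow_ne_zero _ (by norm_num)) hx'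
      · exact ⟨xt 0, h0⟩

/-- **All minors at once.** If `T` meets every `(r+1) × (r+1)` submatrix, some integer point
makes every minor of `U Vᵀ + C_T` nonzero simultaneously (product of the finitely many minor
polynomials is a nonzero polynomial over the infinite domain `ℤ`). [folklore] -/
theorem exists_point_forall_minor_ne_zero {n r : ℕ} (T : Finset (Fin n × Fin n))
    (hT : ∀ R C : Finset (Fin n), R.card = r + 1 → C.card = r + 1 → ∃ p ∈ T, p.1 ∈ R ∧ p.2 ∈ C) :
    ∃ x : PertVars n r → ℤ, ∀ (k : ℕ) (ρ κ : Fin k ↪ Fin n),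
      ((pertMatrix T x).submatrix ρ κ).det ≠ 0 := by
  classical
  let ι : Type := Σ k : Fin (n + 1), (Fin k ↪ Fin n) × (Fin k ↪ Fin n)
  let P : ι → MvPolynomial (PertVars n r) ℤ := fun i =>
    ((genPertMatrix T).submatrix i.2.1 i.2.2).det
  have hP : ∀ i, P i ≠ 0 := by
    intro i hzero
    obtain ⟨x, hx⟩ := exists_point_minor_ne_zero T hT i.1 i.2.1 i.2.2
    apply hx
    rw [← eval_det_genPertMatrix_submatrix]
    change MvPolynomial.eval x (P i) = 0
    rw [hzero, map_zero]
  have hprod : (∏ i, P i) ≠ 0 := Finset.prod_ne_zero_iff.mpr fun i _ => hP i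
  obtain ⟨x, hx⟩ : ∃ x : PertVars n r → ℤ, MvPolynomial.eval x (∏ i, P i) ≠ 0 := by
    by_contra h
    push Not at h
    exact hprod (MvPolynomial.funext fun x => by rw [h x, map_zero])
  refine ⟨x, fun k ρ κ => ?_⟩
  have hk : k < n + 1 := Nat.lt_succ_of_le (by simpa using Fintype.card_le_of_embedding ρ)
  rw [map_prod] at hx
  have := Finset.prod_ne_zero_iff.mp hx ⟨⟨k, hk⟩, ρ, κ⟩ (Finset.mem_univ _)
  rwa [eval_det_genPertMatrix_submatrix] at this

/-- **Hitting sets are witnessed by totally nonsingular matrices.** If `T` meets every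
`(r+1) × (r+1)` submatrix of the `n × n` array, then some totally nonsingular integer matrix
`A` (over `ℚ`) has `R_A(r) ≤ |T|`: `A = U Vᵀ + C_T` at a generic integer point. So the
untouched-submatrix bound `R_A(r) ≥ τ` (`τ` = least hitting set) is EXACTLY tight over the
class of totally nonsingular matrices. [folklore] -/
theorem exists_totallyNonsingular_rigidity_le_card {n r : ℕ} (T : Finset (Fin n × Fin n))
    (hT : ∀ R C : Finset (Fin n), R.card = r + 1 → C.card = r + 1 → ∃ p ∈ T, p.1 ∈ R ∧ p.2 ∈ C) :
    ∃ A : Matrix (Fin n) (Fin n) ℤ, IsTotallyNonsingular (A.map (Int.cast : ℤ → ℚ)) ∧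
      rigidity (A.map (Int.cast : ℤ → ℚ)) r ≤ T.card := by
  obtain ⟨x, hx⟩ := exists_point_forall_minor_ne_zero T hT
  refine ⟨pertMatrix T x, fun m ρ κ => ?_, rigidity_pertMatrix_le T x⟩
  rw [Matrix.submatrix_map]
  have hdet : (((pertMatrix T x).submatrix ρ κ).map (Int.cast : ℤ → ℚ)).det =
      ((((pertMatrix T x).submatrix ρ κ).det : ℤ) : ℚ) := by
    have := (RingHom.map_det (Int.castRingHom ℚ) ((pertMatrix T x).submatrix ρ κ)).symm
    rwa [RingHom.mapMatrix_apply, Int.coe_castRingHom] at this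
  rw [hdet]
  exact_mod_cast hx m ρ κ

/-- **Limitation (ii), sharp form, proved: total nonsingularity is capped at the step-(2)
quantity itself.** For all `1 ≤ r ≤ n/2` there is a totally nonsingular integer `n × n` matrix
`A` with `R^ℚ_A(r) ≤ 6 (n²/r) ln(n/r)` — the quantity that caps the untouched-submatrix step
(`UntouchedSubmatrixCap`, `untouched_submatrix_cover`), versus the printed
"`R_A(r) = n^{1+o(1)}` for `r = εn`" of Thm. 2.12 (Lokam 2009, PDF p. 25; `Lokam2009_thm_2_12`).
From `untouched_submatrix_cover` and `exists_totallyNonsingular_rigidity_le_card`. [folklore] -/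
theorem totalNonsingularity_cap (n r : ℕ) (h2 : 2 * r ≤ n) (hr : 0 < r) :
    ∃ A : Matrix (Fin n) (Fin n) ℤ, IsTotallyNonsingular (A.map (Int.cast : ℤ → ℚ)) ∧
      (rigidity (A.map (Int.cast : ℤ → ℚ)) r : ℝ) ≤
        6 * ((n : ℝ) ^ 2 / r) * Real.log ((n : ℝ) / r) := by
  obtain ⟨T, hTcard, hT⟩ := untouched_submatrix_cover n r h2 hr
  obtain ⟨A, hA, hR⟩ := exists_totallyNonsingular_rigidity_le_card T hT
  exact ⟨A, hA, le_trans (by exact_mod_cast hR) hTcard⟩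

/-- **`O(n)` at rank `εn`.** For every `ε > 0` there is `c` such that for all large `n` some
totally nonsingular integer `n × n` matrix has `R^ℚ(⌈εn⌉) ≤ c · n` (take `r = ⌈ε' n⌉`,
`ε' = min ε (1/4)`, `c = (6/ε') ln(1/ε')`). [folklore] -/
theorem exists_totallyNonsingular_rigidity_linear (ε : ℝ) (hε : 0 < ε) :
    ∃ c : ℝ, ∀ᶠ n : ℕ in atTop, ∃ A : Matrix (Fin n) (Fin n) ℤ,
      IsTotallyNonsingular (A.map (Int.cast : ℤ → ℚ)) ∧
      (rigidity (A.map (Int.cast : ℤ → ℚ)) ⌈ε * n⌉₊ : ℝ) ≤ c * n := by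
  set ε' : ℝ := min ε (1 / 4) with hε'
  have hε'0 : 0 < ε' := lt_min hε (by norm_num)
  have hε'4 : ε' ≤ 1 / 4 := min_le_right _ _
  have hε'ε : ε' ≤ ε := min_le_left _ _
  refine ⟨6 / ε' * Real.log (1 / ε'), ?_⟩
  filter_upwards [eventually_ge_atTop 4] with n hn
  have hnR : (4 : ℝ) ≤ n := by exact_mod_cast hn
  have hnpos : (0 : ℝ) < n := by linarith
  set r : ℕ := ⌈ε' * n⌉₊ with hr
  have hr0 : 0 < r := Nat.ceil_pos.mpr (by positivity)
  have hrge : ε' * n ≤ r := Nat.le_ceil _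
  have hrlt : (r : ℝ) < ε' * n + 1 := Nat.ceil_lt_add_one (by positivity)
  have h2r : 2 * r ≤ n := by
    have : (2 : ℝ) * r ≤ n := by nlinarith
    exact_mod_cast this
  obtain ⟨A, hA, hR⟩ := totalNonsingularity_cap n r h2r hr0
  refine ⟨A, hA, ?_⟩
  have hmono :
      rigidity (A.map (Int.cast : ℤ → ℚ)) ⌈ε * n⌉₊ ≤ rigidity (A.map (Int.cast : ℤ → ℚ)) r :=
    rigidity_anti _ (Nat.ceil_mono (by nlinarith))
  have hrR : (0 : ℝ) < r := by exact_mod_cast hr0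
  have h1 : (n : ℝ) ^ 2 / r ≤ n / ε' := by
    rw [div_le_div_iff₀ hrR hε'0]
    nlinarith
  have h2 : Real.log ((n : ℝ) / r) ≤ Real.log (1 / ε') := by
    apply Real.log_le_log (by positivity)
    rw [div_le_div_iff₀ hrR hε'0]
    nlinarith
  have h3 : 0 ≤ Real.log ((n : ℝ) / r) := by
    apply Real.log_nonneg
    rw [le_div_iff₀ hrR]
    have : (2 : ℝ) * r ≤ n := by exact_mod_cast h2r
    linarith
  calc (rigidity (A.map (Int.cast : ℤ → ℚ)) ⌈ε * n⌉₊ : ℝ)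
      ≤ rigidity (A.map (Int.cast : ℤ → ℚ)) r := by exact_mod_cast hmono
    _ ≤ 6 * ((n : ℝ) ^ 2 / r) * Real.log ((n : ℝ) / r) := hR
    _ ≤ 6 * (n / ε') * Real.log (1 / ε') := by gcongr
    _ = 6 / ε' * Real.log (1 / ε') * n := by ring

/-- **The pointwise reading of Thm. 2.12, now unconditional**: for every `ε, η > 0` and all
large `n` there is a totally nonsingular integer `n × n` matrix with `R^ℚ(⌈εn⌉) ≤ n^{1+η}`
(cf. `Lokam2009_thm_2_12.forall_eventually_exists`, which derived this from the named fact).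
[folklore] -/
theorem forall_eventually_exists_totallyNonsingular :
    ∀ ε : ℝ, 0 < ε → ∀ η : ℝ, 0 < η → ∀ᶠ n : ℕ in atTop,
      ∃ A : Matrix (Fin n) (Fin n) ℤ,
        IsTotallyNonsingular (A.map (Int.cast : ℤ → ℚ)) ∧
        (rigidity (A.map (Int.cast : ℤ → ℚ)) ⌈ε * n⌉₊ : ℝ) ≤ (n : ℝ) ^ (1 + η) := by
  intro ε hε η hη
  obtain ⟨c, hc⟩ := exists_totallyNonsingular_rigidity_linear ε hε
  have hpow : Tendsto (fun n : ℕ => (n : ℝ) ^ η) atTop atTop :=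
    (tendsto_rpow_atTop hη).comp tendsto_natCast_atTop_atTop
  filter_upwards [hc, hpow.eventually_ge_atTop c, eventually_gt_atTop 0] with n hn hcn hn0
  obtain ⟨A, hA, hR⟩ := hn
  refine ⟨A, hA, hR.trans ?_⟩
  have hnpos : (0 : ℝ) < n := by exact_mod_cast hn0
  rw [Real.rpow_add hnpos, Real.rpow_one]
  calc c * n ≤ (n : ℝ) ^ η * n := mul_le_mul_of_nonneg_right hcn hnpos.le
    _ = n * (n : ℝ) ^ η := mul_comm _ _

open Classical in
/-- **The untouched-submatrix step for totally nonsingular matrices** (the proof of Thm. 2.5,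
abstract form): if `A` is totally nonsingular and every set of fewer than `R₀` positions leaves
some `(r+1) × (r+1)` submatrix untouched, then `R_A(r) ≥ R₀` (the untouched submatrix of
`A + C` is a nonsingular submatrix of `A`, so `rank (A + C) ≥ r + 1`).
[cite: Lokam2009, Lemma 2.4 and proof of Thm. 2.5 (PDF pp. 19–20)] -/
theorem IsTotallyNonsingular.le_rigidity {n r : ℕ} {F : Type*} [Field F]
    {A : Matrix (Fin n) (Fin n) F} (hA : IsTotallyNonsingular A) (R₀ : ℕ)
    (harg : ∀ T : Finset (Fin n × Fin n), T.card < R₀ →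
      ∃ (R C : Finset (Fin n)), R.card = r + 1 ∧ C.card = r + 1 ∧
        ∀ p ∈ T, ¬ (p.1 ∈ R ∧ p.2 ∈ C)) :
    R₀ ≤ rigidity A r := by
  have hne : {s | ∃ C : Matrix (Fin n) (Fin n) F, (A + C).rank ≤ r ∧ nnzEntries C = s}.Nonempty :=
    ⟨_, -A, by simp [Matrix.rank_zero], rfl⟩
  obtain ⟨C₀, hC₀, hs⟩ := Nat.sInf_mem hne
  by_contra hlt
  push Not at hlt
  set T : Finset (Fin n × Fin n) := univ.filter fun p : Fin n × Fin n => C₀ p.1 p.2 ≠ 0 with hT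
  have hTcard : T.card < R₀ := by
    have : T.card = nnzEntries C₀ := rfl
    rw [this, hs]
    exact hlt
  obtain ⟨R, C, hR, hC, hmiss⟩ := harg T hTcard
  set ρ : Fin (r + 1) ↪ Fin n := (R.orderEmbOfFin hR).toEmbedding with hρ
  set κ : Fin (r + 1) ↪ Fin n := (C.orderEmbOfFin hC).toEmbedding with hκ
  have hsub : (A + C₀).submatrix ρ κ = A.submatrix ρ κ := by
    ext i j
    simp only [submatrix_apply, Matrix.add_apply, add_eq_left]
    by_contra hne0
    have hmem : (ρ i, κ j) ∈ T := by
      rw [hT, Finset.mem_filter]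
      exact ⟨Finset.mem_univ _, hne0⟩
    exact hmiss _ hmem ⟨R.orderEmbOfFin_mem hR i, C.orderEmbOfFin_mem hC j⟩
  have hunit : IsUnit ((A + C₀).submatrix ρ κ) := by
    rw [hsub, Matrix.isUnit_iff_isUnit_det, isUnit_iff_ne_zero]
    exact hA (r + 1) ρ κ
  have hrank : r + 1 ≤ (A + C₀).rank := by
    calc r + 1 = Fintype.card (Fin (r + 1)) := (Fintype.card_fin _).symm
      _ = ((A + C₀).submatrix ρ κ).rank := (Matrix.rank_of_isUnit _ hunit).symm
      _ ≤ (A + C₀).rank := Matrix.rank_submatrix_le _ _ _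
  omega

/-- **Exactness.** Over totally nonsingular matrices the untouched-submatrix bound is exactly
tight: the least `R^ℚ_A(r)` over totally nonsingular integer `n × n` matrices equals the least
size of a set of positions meeting every `(r+1) × (r+1)` submatrix — lower bound by
`IsTotallyNonsingular.le_rigidity`, upper bound by `exists_totallyNonsingular_rigidity_le_card`.
Stated: a hitting set of size `≤ m` exists iff a totally nonsingular matrix of rigidity `≤ m`
exists. [folklore] -/
theorem exists_hitting_iff_exists_totallyNonsingular {n r : ℕ} (m : ℕ) :
    (∃ T : Finset (Fin n × Fin n), T.card ≤ m ∧
      ∀ R C : Finset (Fin n), R.card = r + 1 → C.card = r + 1 → ∃ p ∈ T, p.1 ∈ R ∧ p.2 ∈ C) ↔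
    (∃ A : Matrix (Fin n) (Fin n) ℤ, IsTotallyNonsingular (A.map (Int.cast : ℤ → ℚ)) ∧
      rigidity (A.map (Int.cast : ℤ → ℚ)) r ≤ m) := by
  classical
  constructor
  · rintro ⟨T, hTm, hT⟩
    obtain ⟨A, hA, hR⟩ := exists_totallyNonsingular_rigidity_le_card T hT
    exact ⟨A, hA, hR.trans hTm⟩
  · rintro ⟨A, hA, hR⟩
    by_contra hno
    push Not at hno
    have key := hA.le_rigidity (rigidity (A.map (Int.cast : ℤ → ℚ)) r + 1) fun T hT => by
      have hTm : T.card ≤ m := by omega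
      obtain ⟨R, C, hRc, hCc, hmiss⟩ := hno T hTm
      exact ⟨R, C, hRc, hCc, fun p hp hpRC => hmiss p hp hpRC.1 hpRC.2⟩
    omega

/-! ### Thm. 2.12 in its printed one-family form, proved -/

/-- A totally nonsingular integer matrix exists in every dimension (the witness of
`exists_totallyNonsingular_rigidity_le_card` for `T = univ`, `r = 0`). [folklore] -/
theorem exists_isTotallyNonsingular (n : ℕ) :
    ∃ A : Matrix (Fin n) (Fin n) ℤ, IsTotallyNonsingular (A.map (Int.cast : ℤ → ℚ)) := by
  obtain ⟨A, hA, -⟩ := exists_totallyNonsingular_rigidity_le_card (n := n) (r := 0)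
    (Finset.univ : Finset (Fin n × Fin n)) (fun R C hR hC => by
      obtain ⟨i, hi⟩ : R.Nonempty := by rw [← Finset.card_pos]; omega
      obtain ⟨j, hj⟩ : C.Nonempty := by rw [← Finset.card_pos]; omega
      exact ⟨(i, j), Finset.mem_univ _, hi, hj⟩)
  exact ⟨A, hA⟩

/-- Arithmetic of the vanishing rank `r = ⌊n / ⌊log₂ n⌋⌋` for `n ≥ 4`: `1 ≤ r`, `2r ≤ n`, and the
step-(2) quantity there is `6 (n²/r) ln(n/r) ≤ 24 n ln² n` (as `n²/r ≤ 2 n ⌊log₂ n⌋`,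
`⌊log₂ n⌋ ≤ 2 ln n`, `ln(n/r) ≤ ln n`). [folklore] -/
theorem div_log_rank_bound {n : ℕ} (hn : 4 ≤ n) :
    0 < n / Nat.log 2 n ∧ 2 * (n / Nat.log 2 n) ≤ n ∧
      6 * ((n : ℝ) ^ 2 / (n / Nat.log 2 n : ℕ)) * Real.log ((n : ℝ) / (n / Nat.log 2 n : ℕ)) ≤
        24 * n * (Real.log n) ^ 2 := by
  set L := Nat.log 2 n with hL
  have hL2 : 2 ≤ L := Nat.le_log_of_pow_le (by norm_num) (by norm_num; exact hn)
  have hLn : L ≤ n := Nat.log_le_self 2 n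
  have hLpos : 0 < L := by omega
  set r := n / L with hr
  have hrpos : 0 < r := Nat.div_pos hLn hLpos
  have h2r : 2 * r ≤ n := by
    have : n / L ≤ n / 2 := Nat.div_le_div_left hL2 (by norm_num)
    omega
  refine ⟨hrpos, h2r, ?_⟩
  have hn0 : n ≠ 0 := by omega
  have hnR : (4 : ℝ) ≤ n := by exact_mod_cast hn
  have hnpos : (0 : ℝ) < n := by linarith
  have hrR : (1 : ℝ) ≤ r := by exact_mod_cast hrpos
  have hrpos' : (0 : ℝ) < r := by linarith
  have hLR : (2 : ℝ) ≤ L := by exact_mod_cast hL2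
  have hnlt : (n : ℝ) < L * (r + 1) := by
    have : n < L * (n / L + 1) := Nat.lt_mul_div_succ n hLpos
    exact_mod_cast this
  have hlogn : 0 < Real.log n := Real.log_pos (by linarith)
  have hLlog : (L : ℝ) ≤ 2 * Real.log n := by
    have h1 : (L : ℝ) * Real.log 2 ≤ Real.log n := by
      apply Real.le_log_of_pow_le (by norm_num)
      exact_mod_cast Nat.pow_log_le_self 2 hn0
    have := Real.log_two_gt_d9
    nlinarith
  have hA : (n : ℝ) ^ 2 / r ≤ 2 * n * L := by
    rw [div_le_iff₀ hrpos']
    have : (n : ℝ) ≤ 2 * L * r := by nlinarith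
    nlinarith
  have hB : Real.log ((n : ℝ) / r) ≤ Real.log n := by
    apply Real.log_le_log (by positivity)
    exact div_le_self hnpos.le hrR
  have hB0 : 0 ≤ Real.log ((n : ℝ) / r) := by
    apply Real.log_nonneg
    rw [le_div_iff₀ hrpos']
    have : (2 : ℝ) * r ≤ n := by exact_mod_cast h2r
    linarith
  calc 6 * ((n : ℝ) ^ 2 / r) * Real.log ((n : ℝ) / r)
      ≤ 6 * (2 * n * L) * Real.log n := by gcongr
    _ ≤ 6 * (2 * n * (2 * Real.log n)) * Real.log n := by gcongr
    _ = 24 * n * (Real.log n) ^ 2 := by ring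

/-- **One totally nonsingular family of rigidity `O(n log² n)` at the vanishing rank
`⌊n / ⌊log₂ n⌋⌋`.** There is a family `A_n` of totally nonsingular integer matrices (over `ℚ`)
with `R^ℚ_{A_n}(⌊n/⌊log₂ n⌋⌋) ≤ 24 n ln² n` for all `n ≥ 4`: the witness of
`totalNonsingularity_cap` at `r = ⌊n/⌊log₂ n⌋⌋` (`div_log_rank_bound`), and any totally
nonsingular matrix for `n < 4`. [folklore] -/
theorem exists_family_totallyNonsingular_rigidity_le :
    ∃ A : (n : ℕ) → Matrix (Fin n) (Fin n) ℤ,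
      (∀ n, IsTotallyNonsingular ((A n).map (Int.cast : ℤ → ℚ))) ∧
      ∀ n, 4 ≤ n →
        (rigidity ((A n).map (Int.cast : ℤ → ℚ)) (n / Nat.log 2 n) : ℝ) ≤
          24 * n * (Real.log n) ^ 2 := by
  have key : ∀ n : ℕ, ∃ A : Matrix (Fin n) (Fin n) ℤ,
      IsTotallyNonsingular (A.map (Int.cast : ℤ → ℚ)) ∧
      (4 ≤ n → (rigidity (A.map (Int.cast : ℤ → ℚ)) (n / Nat.log 2 n) : ℝ) ≤
        24 * n * (Real.log n) ^ 2) := by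
    intro n
    by_cases hn : 4 ≤ n
    · obtain ⟨hr, h2r, hbound⟩ := div_log_rank_bound hn
      obtain ⟨A, hA, hR⟩ := totalNonsingularity_cap n (n / Nat.log 2 n) h2r hr
      exact ⟨A, hA, fun _ => hR.trans hbound⟩
    · obtain ⟨A, hA⟩ := exists_isTotallyNonsingular n
      exact ⟨A, hA, fun h => absurd h hn⟩
  choose A hA hR using key
  exact ⟨A, hA, hR⟩

/-- **Thm. 2.12 (Valiant; Lokam 2009), one family for every `ε`, PROVED**: there is ONE family of
totally nonsingular integer `n × n` matrices `A_n` such that for every `ε > 0` and every `η > 0`,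
`R^ℚ_{A_n}(⌈εn⌉) ≤ n^{1+η}` for all large `n` — the named fact `Lokam2009_thm_2_12` ("There exist
`n × n` matrices `A` with integer entries such that all submatrices of `A` of all sizes are
nonsingular, and yet `R_A(r) = n^{1+o(1)}` for `r = εn` for any `ε > 0`", upper-bound half as
vendored). The printed proof (PDF pp. 25–26) builds `A` from a linear-size logarithmic-depth
superconcentrator and applies Thm. 2.1's decomposition; the proof here instead takes the family
of `exists_family_totallyNonsingular_rigidity_le` — rigidity `≤ 24 n ln² n` already at rank
`⌊n/⌊log₂ n⌋⌋`, which is eventually below `⌈εn⌉` for every fixed `ε > 0` — and antitonicity of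
rigidity in the target rank (`rigidity_anti`), with `24 ln² n ≤ n^η` eventually
(`isLittleO_log_rpow_atTop`). [cite: Lokam2009, Thm. 2.12 (PDF p. 25)] -/
theorem Lokam2009_thm_2_12_holds : Lokam2009_thm_2_12 := by
  obtain ⟨A, hA, hR⟩ := exists_family_totallyNonsingular_rigidity_le
  refine ⟨A, hA, fun ε hε η hη => ?_⟩
  set K : ℕ := ⌈1 / ε⌉₊ with hK
  have hK1 : 1 / ε ≤ K := Nat.le_ceil _
  have hKpos : 0 < K := Nat.ceil_pos.mpr (by positivity)
  have hlog : ∀ᶠ n : ℕ in atTop, Real.log n ≤ 1 / 5 * (n : ℝ) ^ (η / 2) := by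
    have h := ((isLittleO_log_rpow_atTop (half_pos hη)).comp_tendsto
      tendsto_natCast_atTop_atTop).bound (by norm_num : (0 : ℝ) < 1 / 5)
    filter_upwards [h, eventually_ge_atTop 1] with n hn hn1
    have hn1' : (1 : ℝ) ≤ n := by exact_mod_cast hn1
    rw [Function.comp_apply, Function.comp_apply, Real.norm_of_nonneg (Real.log_nonneg hn1'),
      Real.norm_of_nonneg (by positivity)] at hn
    exact hn
  filter_upwards [eventually_ge_atTop 4, eventually_ge_atTop (2 ^ K), hlog] with n hn4 hnK hlogn
  have hnR : (4 : ℝ) ≤ n := by exact_mod_cast hn4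
  have hnpos : (0 : ℝ) < n := by linarith
  have hL : K ≤ Nat.log 2 n := Nat.le_log_of_pow_le (by norm_num) hnK
  have hKR : (0 : ℝ) < K := by exact_mod_cast hKpos
  have hrank : n / Nat.log 2 n ≤ ⌈ε * n⌉₊ := by
    have h1 : ((n / Nat.log 2 n : ℕ) : ℝ) ≤ ε * n := by
      calc ((n / Nat.log 2 n : ℕ) : ℝ) ≤ (n : ℝ) / (Nat.log 2 n : ℕ) := Nat.cast_div_le
        _ ≤ (n : ℝ) / K := by
            apply div_le_div_of_nonneg_left hnpos.le hKR
            exact_mod_cast hL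
        _ ≤ ε * n := by
            rw [div_le_iff₀ hKR]
            have hKR' : 1 / ε ≤ (K : ℝ) := hK1
            rw [div_le_iff₀ hε] at hKR'
            nlinarith
    exact_mod_cast h1.trans (Nat.le_ceil _)
  have hlog0 : 0 ≤ Real.log n := Real.log_nonneg (by linarith)
  have hsq : (Real.log n) ^ 2 ≤ 1 / 25 * (n : ℝ) ^ η := by
    calc (Real.log n) ^ 2 = Real.log n * Real.log n := sq _
      _ ≤ (1 / 5 * (n : ℝ) ^ (η / 2)) * (1 / 5 * (n : ℝ) ^ (η / 2)) :=
          mul_le_mul hlogn hlogn hlog0 (by positivity)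
      _ = 1 / 25 * ((n : ℝ) ^ (η / 2) * (n : ℝ) ^ (η / 2)) := by ring
      _ = 1 / 25 * (n : ℝ) ^ η := by rw [← Real.rpow_add hnpos, add_halves]
  have hpow0 : 0 ≤ (n : ℝ) ^ η := Real.rpow_nonneg hnpos.le η
  calc (rigidity ((A n).map (Int.cast : ℤ → ℚ)) ⌈ε * n⌉₊ : ℝ)
      ≤ rigidity ((A n).map (Int.cast : ℤ → ℚ)) (n / Nat.log 2 n) := by
        exact_mod_cast rigidity_anti _ hrank
    _ ≤ 24 * n * (Real.log n) ^ 2 := hR n hn4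
    _ ≤ 24 * n * (1 / 25 * (n : ℝ) ^ η) := by gcongr
    _ ≤ n * (n : ℝ) ^ η := by nlinarith
    _ = (n : ℝ) ^ (1 + η) := by rw [Real.rpow_add hnpos, Real.rpow_one]

/-- **The barrier of purely combinatorial approaches to rigidity, PROVED** (discharge of the
named barrier `RigidityCombinatorialBarrier = UntouchedSubmatrixCap ∧ Lokam2009_thm_2_12`):
clause (i) is `untouched_submatrix_cover` (main file), clause (ii) is `Lokam2009_thm_2_12_holds`.
[cite: Lokam2009, §2.2.1 (PDF p. 24) and Thm. 2.12 (PDF p. 25)] -/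
theorem RigidityCombinatorialBarrier_holds : RigidityCombinatorialBarrier :=
  ⟨untouched_submatrix_cover, Lokam2009_thm_2_12_holds⟩

/-- **Total nonsingularity does not imply Valiant-rigidity, unconditionally**: ONE family of
totally nonsingular integer matrices `A_n` with `R^ℚ_{A_n}(⌈εn⌉) < n^{1+δ}` eventually, for
every `ε, δ > 0` (`Lokam2009_thm_2_12.exists_totallyNonsingular_not_rigid` fed with
`Lokam2009_thm_2_12_holds`). [cite: Lokam2009, Thm. 2.12 (PDF p. 25)] -/
theorem exists_family_totallyNonsingular_not_rigid :
    ∃ A : (n : ℕ) → Matrix (Fin n) (Fin n) ℤ,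
      (∀ n, IsTotallyNonsingular ((A n).map (Int.cast : ℤ → ℚ))) ∧
      ∀ ε : ℝ, 0 < ε → ∀ δ : ℝ, 0 < δ → ∀ᶠ n : ℕ in atTop,
        (rigidity ((A n).map (Int.cast : ℤ → ℚ)) ⌈ε * n⌉₊ : ℝ) < (n : ℝ) ^ (1 + δ) :=
  Lokam2009_thm_2_12_holds.exists_totallyNonsingular_not_rigid

/-- **Discharge of the named clause `TotalNonsingularityCap`** (main file, limitation (ii) in
sharp form): for all `1 ≤ r ≤ n/2` some totally nonsingular integer `n × n` matrix `A` has
`R^ℚ_A(r) ≤ 6 (n²/r) ln(n/r)`. The named `def TotalNonsingularityCap : Prop` is, verbatim, the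
type of `totalNonsingularity_cap` above (hitting set of `untouched_submatrix_cover` made the
sparse part of a generic `U Vᵀ + C_T`, `exists_totallyNonsingular_rigidity_le_card`), so the
discharge is that theorem. Source of the printed (weaker, one-family `n^{1+o(1)}` at `r = εn`)
form: Lokam 2009, §2.2.1 "Limitations of the Combinatorial Proof Techniques" (PDF p. 24: the
`O((n²/r) log(n/(r+1)))` cover of all `(r+1) × (r+1)` submatrices) and Thm. 2.12 (PDF p. 25:
"There exist an `n × n` matrices `A` with integer entries such that all submatrices of `A` of
all sizes are nonsingular, and yet `R_A(r) = n^{1+o(1)}` for `r = εn` for any `ε > 0`").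
[cite: Lokam2009, §2.2.1 (PDF p. 24) and Thm. 2.12 (PDF p. 25)] -/
theorem TotalNonsingularityCap_holds : TotalNonsingularityCap :=
  fun n r h2 hr => totalNonsingularity_cap n r h2 hr

end Literature.Barriers.PneNP

end
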